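import Mathlib.Analysis.InnerProductSpace.Dual
import Mathlib.Analysis.LocallyConvex.Separation
import Mathlib.Analysis.Normed.Affine.AddTorsorBases
import Mathlib.Analysis.Convex.Topology
import Literature.Geometry.DiscreteGeometry.RankinOrthoplexBound
import HarnessLib

/-!
# A maximal arrangement with the fewest edges is balanced: it meets every open hemisphere and
# has the centre in the interior of its convex hull — proved

Topic `Literature/Geometry/DiscreteGeometry`; brick 7 toward the named fact
`musinTarasov2012_tammes_thirteen` (O. R. Musin, A. S. Tarasov, *The strong thirteen spheres
problem*, Discrete Comput. Geom. 48 (2012) 128–141 [`MusinTarasov2012`]), theorem-only companion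
of `SphericalCodeOptimal.lean` (`IsTammesOptimal`, `HasShift`, Proposition 3.2's shift half
`IsTammesOptimal.not_hasShift`) and `RankinOrthoplexBound.lean` (`ψ < √2` for `N > 2 dim E`).

§3.2 of the paper works with the faces of the contact graph `CG(X)` of a maximal arrangement as
bounded convex spherical polygons ("Note that all faces of `CG(X)` are convex polygons"), and §4
enumerates `CG(X)` as a plane graph whose faces tile the sphere.  The standing fact behind this —
that the points of a maximal arrangement are not confined to a hemisphere, so that the contact
graph surrounds the centre and `conv X` is a full-dimensional polytope with `0` in its interior
(whose boundary, projected radially, carries the face structure) — is proved here, for the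
maximal arrangements with the fewest edges of `SphericalCodeOptimal.lean`, in any
finite-dimensional real inner product space with `N > 2 dim E` points (on `S²`: `N ≥ 7`).

## What is proved

* `hasShift_of_forall_inner_nonneg` — if `ψ(x) < √2` and all points lie in a closed hemisphere
  `⟪u, ·⟫ ≥ 0`, the antipode `−u` is at distance `≥ √2 > ψ` from every point, so EVERY label
  admits a shift (relocation form);
* **`IsTammesOptimal.exists_inner_neg_of_ne_zero`** / `…exists_inner_pos_of_ne_zero` — hence
  (Proposition 3.2: no vertex of positive degree of a maximal arrangement with the fewest edges
  admits a shift, and `ψ` is attained) such an arrangement has a point strictly inside each open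
  hemisphere: `∀ v ≠ 0, ∃ j, ⟪v, x j⟫ < 0` and `∃ j, ⟪v, x j⟫ > 0`;
* `IsTammesOptimal.span_eq_top`, `IsTammesOptimal.affineSpan_eq_top` — the points span the
  space linearly and affinely;
* **`IsTammesOptimal.zero_mem_interior_convexHull`** — `0 ∈ interior (conv X)` (separation:
  a functional supporting `interior (conv X)` at `0` would be `≤ 0` on all points);
* `…_of_seven_le` specialisations to `S² ⊂ ℝ³`, `N ≥ 7`.

## References

* O. R. Musin, A. S. Tarasov, Discrete Comput. Geom. 48 (2012) 128–141 = arXiv:1002.1439, §2.1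
  (shifts), Proposition 3.2, §3.2. [`MusinTarasov2012`]
-/

noncomputable section

namespace Literature.Geometry.DiscreteGeometry

open Real RealInnerProductSpace Finset Module

section Balanced

variable {E : Type*} [NormedAddCommGroup E] [InnerProductSpace ℝ E] {N : ℕ}

/-- **The jump to the pole of an empty hemisphere is a shift.**  If all points of a unit
configuration `x` with `ψ(x) < √2` lie in the closed hemisphere `⟪u, ·⟫ ≥ 0` of a unit vector `u`,
then every label `i` admits a shift (in the relocation form of `HasShift`): the antipode `−u` is
at distance `≥ √2 > ψ(x)` from every point. [folklore] -/
theorem hasShift_of_forall_inner_nonneg {x : Fin N → E} (hx : x ∈ unitConfigs N E)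
    (hψ : minDist x < Real.sqrt 2) {u : E} (hu : ‖u‖ = 1) (h : ∀ j, 0 ≤ ⟪u, x j⟫) (i : Fin N) :
    HasShift x i := by
  refine ⟨-u, by rw [norm_neg, hu], fun j _ => ?_⟩
  have h2 : Real.sqrt 2 ≤ dist (-u) (x j) := by
    have hd : dist (-u) (x j) ^ 2 = 2 + 2 * ⟪u, x j⟫ := by
      rw [dist_eq_norm, show -u - x j = -(u + x j) by abel, norm_neg, norm_add_sq_real, hu, hx j]
      ring
    calc Real.sqrt 2 ≤ Real.sqrt (dist (-u) (x j) ^ 2) :=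
          Real.sqrt_le_sqrt (by rw [hd]; linarith [h j])
      _ = dist (-u) (x j) := Real.sqrt_sq dist_nonneg
  exact hψ.trans_le h2

/-- **A maximal arrangement with the fewest edges is not contained in any closed hemisphere**
(`N > 2 dim E`; on `S²`: `N ≥ 7`): for every `v ≠ 0` some point satisfies `⟪v, x j⟫ < 0`.
Otherwise, by `hasShift_of_forall_inner_nonneg`, a vertex of positive degree (there is one:
`ψ` is attained) would admit a shift, contradicting Proposition 3.2
(`IsTammesOptimal.not_hasShift`).  This is the standing assumption behind "all faces of `CG(X)`
are convex polygons" (§3.2): the vertex set surrounds the centre.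
[folklore] [cite: MusinTarasov2012, Proposition 3.2 and §3.2] -/
theorem IsTammesOptimal.exists_inner_neg_of_ne_zero [FiniteDimensional ℝ E] {x : Fin N → E}
    (hopt : IsTammesOptimal N E x) (hN : 2 * finrank ℝ E < N) {v : E} (hv : v ≠ 0) :
    ∃ j, ⟪v, x j⟫ < 0 := by
  by_contra hcon
  push Not at hcon
  have hN1 : 0 < N := by omega
  have hE : Nontrivial E := by
    refine ⟨⟨x ⟨0, hN1⟩, 0, fun e => ?_⟩⟩
    have := hopt.mem ⟨0, hN1⟩
    rw [e, norm_zero] at this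
    exact zero_ne_one this
  have hfr : 0 < finrank ℝ E := finrank_pos
  have hN2 : 2 ≤ N := by omega
  have hne : (distinctPairs N).Nonempty :=
    distinctPairs_nonempty (i := ⟨0, by omega⟩) (j := ⟨1, by omega⟩) (by simp [Fin.ext_iff])
  obtain ⟨⟨i, j⟩, hij⟩ := contactPairs_nonempty x hne
  set u : E := ‖v‖⁻¹ • v with hudef
  have hu : ‖u‖ = 1 := by
    rw [hudef, norm_smul, norm_inv, norm_norm, inv_mul_cancel₀ (norm_ne_zero_iff.2 hv)]
  have hu' : ∀ k, 0 ≤ ⟪u, x k⟫ := fun k => by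
    rw [hudef, real_inner_smul_left]
    exact mul_nonneg (inv_nonneg.2 (norm_nonneg v)) (hcon k)
  exact hopt.not_hasShift ⟨j, hij⟩
    (hasShift_of_forall_inner_nonneg hopt.mem (minDist_lt_sqrt_two hopt.mem hN) hu hu' i)

/-- … equivalently, **every open hemisphere contains a point**: for every `v ≠ 0` some point has
`⟪v, x j⟫ > 0`. [folklore] -/
theorem IsTammesOptimal.exists_inner_pos_of_ne_zero [FiniteDimensional ℝ E] {x : Fin N → E}
    (hopt : IsTammesOptimal N E x) (hN : 2 * finrank ℝ E < N) {v : E} (hv : v ≠ 0) :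
    ∃ j, 0 < ⟪v, x j⟫ := by
  obtain ⟨j, hj⟩ := hopt.exists_inner_neg_of_ne_zero hN (neg_ne_zero.2 hv)
  exact ⟨j, by rwa [inner_neg_left, neg_lt_zero] at hj⟩

/-- Hence **the points span the space linearly** … [folklore] -/
theorem IsTammesOptimal.span_eq_top [FiniteDimensional ℝ E] {x : Fin N → E}
    (hopt : IsTammesOptimal N E x) (hN : 2 * finrank ℝ E < N) :
    Submodule.span ℝ (Set.range x) = ⊤ := by
  rw [← Submodule.orthogonal_eq_bot_iff]
  by_contra hbot
  obtain ⟨v, hv, hv0⟩ := Submodule.exists_mem_ne_zero_of_ne_bot hbot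
  obtain ⟨j, hj⟩ := hopt.exists_inner_neg_of_ne_zero hN hv0
  have : ⟪v, x j⟫ = 0 := by
    rw [real_inner_comm]
    exact (Submodule.mem_orthogonal _ v).1 hv (x j) (Submodule.subset_span ⟨j, rfl⟩)
  exact hj.ne this

/-- … **and affinely** (they are not contained in any affine hyperplane) … [folklore] -/
theorem IsTammesOptimal.affineSpan_eq_top [FiniteDimensional ℝ E] {x : Fin N → E}
    (hopt : IsTammesOptimal N E x) (hN : 2 * finrank ℝ E < N) :
    affineSpan ℝ (Set.range x) = ⊤ := by
  have hN0 : 0 < N := by omega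
  have hne : (affineSpan ℝ (Set.range x) : Set E).Nonempty :=
    ⟨x ⟨0, hN0⟩, mem_affineSpan ℝ ⟨⟨0, hN0⟩, rfl⟩⟩
  rw [← AffineSubspace.direction_eq_top_iff_of_nonempty hne, ← Submodule.orthogonal_eq_bot_iff]
  by_contra hbot
  obtain ⟨v, hv, hv0⟩ := Submodule.exists_mem_ne_zero_of_ne_bot hbot
  have hconst : ∀ j, ⟪v, x j⟫ = ⟪v, x ⟨0, hN0⟩⟫ := by
    intro j
    have hmem : x j -ᵥ x ⟨0, hN0⟩ ∈ (affineSpan ℝ (Set.range x)).direction :=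
      AffineSubspace.vsub_mem_direction (mem_affineSpan ℝ ⟨j, rfl⟩)
        (mem_affineSpan ℝ ⟨⟨0, hN0⟩, rfl⟩)
    have h0 : ⟪v, x j -ᵥ x ⟨0, hN0⟩⟫ = 0 := by
      rw [real_inner_comm]
      exact (Submodule.mem_orthogonal _ v).1 hv _ hmem
    rwa [vsub_eq_sub, inner_sub_right, sub_eq_zero] at h0
  rcases le_or_gt 0 ⟪v, x ⟨0, hN0⟩⟫ with hc | hc
  · obtain ⟨j, hj⟩ := hopt.exists_inner_neg_of_ne_zero hN hv0
    rw [hconst j] at hj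
    exact absurd hc (not_le.2 hj)
  · obtain ⟨j, hj⟩ := hopt.exists_inner_pos_of_ne_zero hN hv0
    rw [hconst j] at hj
    exact absurd hc (not_lt.2 hj.le)

/-- … so that **the centre `0` is an interior point of their convex hull**: `conv X` is a
full-dimensional polytope containing `0` in its interior (the setting in which the contact graph,
drawn on the sphere, has bounded convex faces). [folklore] -/
theorem IsTammesOptimal.zero_mem_interior_convexHull [FiniteDimensional ℝ E] {x : Fin N → E}
    (hopt : IsTammesOptimal N E x) (hN : 2 * finrank ℝ E < N) :
    (0 : E) ∈ interior (convexHull ℝ (Set.range x)) := by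
  set C := convexHull ℝ (Set.range x) with hC
  have hCconv : Convex ℝ C := convex_convexHull ℝ _
  have hint : (interior C).Nonempty :=
    interior_convexHull_nonempty_iff_affineSpan_eq_top.2 (hopt.affineSpan_eq_top hN)
  by_contra h0
  obtain ⟨f, hf⟩ := geometric_hahn_banach_open_point hCconv.interior isOpen_interior h0
  rw [map_zero] at hf
  -- `f ≤ 0` on `C ⊆ closure (interior C)`
  have hle : ∀ j, f (x j) ≤ 0 := by
    intro j
    have hxC : x j ∈ closure (interior C) := by
      rw [hCconv.closure_interior_eq_closure_of_nonempty_interior hint]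
      exact subset_closure (subset_convexHull ℝ _ ⟨j, rfl⟩)
    have hclosed : IsClosed {a : E | f a ≤ 0} := isClosed_le f.continuous continuous_const
    exact (hclosed.closure_subset_iff.2 fun a ha => (hf a ha).le) hxC
  -- `f = ⟪w, ·⟫` with `w ≠ 0`
  set w : E := (InnerProductSpace.toDual ℝ E).symm f with hw
  have hfw : ∀ a, f a = ⟪w, a⟫ := fun a => by rw [hw, InnerProductSpace.toDual_symm_apply]
  have hw0 : w ≠ 0 := by
    intro h
    obtain ⟨p, hp⟩ := hint
    have := hf p hp
    rw [hfw, h, inner_zero_left] at this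
    exact lt_irrefl _ this
  obtain ⟨j, hj⟩ := hopt.exists_inner_pos_of_ne_zero hN hw0
  have := hle j
  rw [hfw] at this
  linarith

/-- `S² ⊂ ℝ³`, `N ≥ 7`: a maximal arrangement with the fewest edges meets every open hemisphere.
[folklore] -/
theorem IsTammesOptimal.exists_inner_pos_of_seven_le {x : Fin N → EuclideanSpace ℝ (Fin 3)}
    (hopt : IsTammesOptimal N (EuclideanSpace ℝ (Fin 3)) x) (hN : 7 ≤ N)
    {v : EuclideanSpace ℝ (Fin 3)} (hv : v ≠ 0) : ∃ j, 0 < ⟪v, x j⟫ :=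
  hopt.exists_inner_pos_of_ne_zero (by rw [finrank_euclideanSpace_fin]; omega) hv

/-- `S² ⊂ ℝ³`, `N ≥ 7`: `0` is interior to the convex hull of a maximal arrangement with the fewest
edges. [folklore] -/
theorem IsTammesOptimal.zero_mem_interior_convexHull_of_seven_le
    {x : Fin N → EuclideanSpace ℝ (Fin 3)} (hopt : IsTammesOptimal N (EuclideanSpace ℝ (Fin 3)) x)
    (hN : 7 ≤ N) : (0 : EuclideanSpace ℝ (Fin 3)) ∈ interior (convexHull ℝ (Set.range x)) :=
  hopt.zero_mem_interior_convexHull (by rw [finrank_euclideanSpace_fin]; omega)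

end Balanced

end Literature.Geometry.DiscreteGeometry

end
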